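import Summits.KontsevichZagierPeriods.KontsevichZagierPeriods.Theorems.SoloInformedPlanarBands
import Summits.KontsevichZagierPeriods.KontsevichZagierPeriods.Theorems.SoloInformedVolumeLadder

/-!
# Rungs 0 and 1 of the volume ladder hold unconditionally

Solo programme `solo-KontsevichZagierPeriods-informed`.  The volume ladder
(`SoloInformedVolumeLadder.lean`) states the Kontsevich–Zagier period conjecture as
`∀ d, SoloInformedVolumeRung d`; Rung 2 was derived from the Huber–Wüstholz theorem on
one-dimensional periods (`SoloInformedRungTwoFinal.lean`).  Here we record that the first two
rungs need no transcendence input at all: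

* `soloInformed_lineRep_const`: a one-dimensional representation `[K, 1]` (`K ⊆ ℝ` of finite
  length) goes down, by the moves (1) and (3) of [Kontsevich–Zagier 2001, §1.2] along the cylindrical
  decomposition of the line adapted to `K` (Basu–Pollack–Roy, Cor. 5.7), to a constant `[pt, v]`
  of dimension `0` (this is `soloInformed_cell_base` over the base `ℝ⁰`);
* `soloInformed_volumeRung_one`: hence two such representations of equal value are equivalent —
  the two constants have equal values by soundness of the calculus (`KZ.Equivalent.value_eq_holds`)
  and a dimension-`0` representation with full domain is determined by its value;
* `soloInformed_volumeRung_le_one`: rungs `d ≤ 1` (the ladder is monotone).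

References: M. Kontsevich, D. Zagier, *Periods* (2001), §1.2 [KontsevichZagier2001];
S. Basu, R. Pollack, M.-F. Roy, *Algorithms in Real Algebraic Geometry* (2006), Cor. 5.7.
-/

noncomputable section

open MeasureTheory Set
open Literature.ModelTheory.ExponentialFields Literature.NumberTheory.Transcendental
open Literature.NumberTheory.Transcendental.KZ

namespace Summit.KontsevichZagierPeriods.KontsevichZagierPeriods.Theorems

/-- **Down to a constant.** A one-dimensional representation with integrand `1` (hence of finite
volume) is equivalent to a representation of dimension `0` with full domain.
[Kontsevich–Zagier 2001, §1.2, rules (1), (3); Basu–Pollack–Roy 2006, Cor. 5.7] -/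
theorem soloInformed_lineRep_const (r : IntegralRep 1) (hr1 : ∀ x ∈ r.domain, r.integrand x = 1) :
    ∃ c : IntegralRep 0, c.domain = univ ∧ of r - of c ∈ relations := by
  classical
  have hS : IsSemialgebraic ℚ r.domain := r.isSemialgebraic_domain
  have hfin : volume r.domain ≠ ⊤ := volume_ne_top_of_integrand_one r hr1
  obtain ⟨𝒮, l, ξ, hcd, -, hξ, hmono, hcells, hfib⟩ :=
    IsSemialgebraic.exists_cylindricalDecomposition.exists_fibre_eq
      (IsSemialgebraic.exists_cylindricalDecomposition_holds (k := ℚ)) hS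
  have h𝒮 : 𝒮 = {univ} := (isCylindricalDecomposition_zero (k := ℚ)).1 hcd
  have huniv : (univ : Set (Fin 0 → ℝ)) ∈ 𝒮 := by rw [h𝒮]; exact Finset.mem_singleton_self _
  obtain ⟨G, B, -, hBsub, hfibC⟩ := hfib univ huniv
  have hvol : volume (univ : Set (Fin 0 → ℝ)) = 1 := by
    rw [volume_pi, Measure.pi_univ, Finset.univ_eq_empty, Finset.prod_empty]
  have hC0 : volume (univ : Set (Fin 0 → ℝ)) ≠ 0 := by rw [hvol]; exact one_ne_zero
  obtain ⟨bL, hbLd, -, -, hrel⟩ := soloInformed_cell_base (m := 0) hS hfin isSemialgebraic_univ hC0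
    (ξ univ) (hξ univ huniv) (hmono univ huniv) G B hBsub (hcells univ huniv).2 hfibC r
    (by ext z; simp) hr1
  exact ⟨bL, hbLd, hrel⟩

/-- The value of a dimension-`0` representation with full domain is its integrand at the point. -/
theorem soloInformed_rep0_value (c : IntegralRep 0) (hc : c.domain = univ) :
    c.value = c.integrand Fin.elim0 := by
  have hf : c.integrand = fun _ => c.integrand Fin.elim0 := by
    funext x; exact congrArg c.integrand (Subsingleton.elim _ _)
  have hvol : volume (univ : Set (Fin 0 → ℝ)) = 1 := by
    rw [volume_pi, Measure.pi_univ, Finset.univ_eq_empty, Finset.prod_empty]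
  rw [IntegralRep.value, hc, Measure.restrict_univ, hf, integral_const, smul_eq_mul,
    measureReal_def, hvol, ENNReal.toReal_one, one_mul]

/-- A dimension-`0` representation with full domain is determined by its value. -/
theorem soloInformed_rep0_eq {c c' : IntegralRep 0} (hc : c.domain = univ) (hc' : c'.domain = univ)
    (hv : c.value = c'.value) : c = c' := by
  have h0 := soloInformed_rep0_value c hc
  have h0' := soloInformed_rep0_value c' hc'
  obtain ⟨d, f, h1, h2, h3⟩ := c
  obtain ⟨d', f', h1', h2', h3'⟩ := c'
  simp only at hc hc' h0 h0' hv
  subst hc hc'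
  have hf : f = f' := by
    funext x
    rw [show x = Fin.elim0 from Subsingleton.elim _ _, ← h0, ← h0', hv]
  subst hf
  rfl

/-- **Rung 1 holds unconditionally**: two compact `ℚ`-semialgebraic subsets of the line with
non-empty interior and equal length are equivalent under the Kontsevich–Zagier rules.
[Kontsevich–Zagier 2001, §1.2] -/
theorem soloInformed_volumeRung_one : SoloInformedVolumeRung 1 := by
  intro r r' _ _ _ _ h1 h1' hv
  obtain ⟨c, hc, hrel⟩ := soloInformed_lineRep_const r h1
  obtain ⟨c', hc', hrel'⟩ := soloInformed_lineRep_const r' h1'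
  have hvc : c.value = c'.value := by
    rw [← Equivalent.value_eq_holds (show Equivalent r c from hrel),
      ← Equivalent.value_eq_holds (show Equivalent r' c' from hrel'), hv]
  have hcc : c = c' := soloInformed_rep0_eq hc hc' hvc
  subst hcc
  show of r - of r' ∈ relations
  have : of r - of r' = (of r - of c) - (of r' - of c) := by abel
  rw [this]
  exact relations.sub_mem hrel hrel'

/-- **Rungs `≤ 1` hold unconditionally** (the ladder is monotone,
`soloInformedVolumeRung_of_le`): points (`d = 0`) and lengths (`d = 1`). -/
theorem soloInformed_volumeRung_le_one {d : ℕ} (hd : d ≤ 1) : SoloInformedVolumeRung d :=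
  soloInformedVolumeRung_of_le hd soloInformed_volumeRung_one

end Summit.KontsevichZagierPeriods.KontsevichZagierPeriods.Theorems
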